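import Literature.NumberTheory.Transcendental.RoySmallValueFactorization
import Literature.NumberTheory.Transcendental.RoySmallValueExponents
import Mathlib.RingTheory.Polynomial.UniqueFactorization
import Mathlib.Algebra.MvPolynomial.Equiv
import HarnessLib

/-!
# Roy's small value estimate for `𝔾ₐ × 𝔾ₘ` — the factorisation of `Φ(P, Q, ·)` over the number field of the zeros

Topic `Literature/NumberTheory/Transcendental`. Part of the formalisation of the proof of Roy 2013,
Theorem 1.1 (named fact `roy2013_thm_1_1`, `RoySmallValueEstimates.lean`), seat B. Source: D. Roy,
*A small value estimate for `𝔾ₐ × 𝔾ₘ`*, Mathematika 59 (2013) 333–363 = arXiv:1301.0663, §2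
(p. 6) and §6, proof of Prop. 6.4 (p. 17):

> [...] its Chow form in degree `D` is the unique homogeneous polynomial map
> `F : ℂ[X]_D → ℂ` such that: 1) `F(P) = 0` if and only if `P ∈ 𝔭`, 2) `F` has integer
> coefficients [...], and 3) the g.c.d. of these coefficients is 1. [...] a factorisation
> `F(P) = a ∏_{α ∈ Z} P(α)` [...] where the points are normalised [...] `Z = e_1 Z_1 + ⋯ + e_s Z_s`
> [...] the points of `Z(ℂ)` are conjugate over `ℚ`.

`RoySmallValueFactorization.royF_eq_C_mul_prod` factors `F = Φ(P, Q, ·)` over `ℂ` as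
`c ∏ ℓ_{αᵢ}^{eᵢ}`. The arithmetic of §§6–7 (Gelfond–Mahler `sum_mul_logHeight_le'`, the "gain"
`prod_mulHeight_pow_le_prod_embeddings`, constancy of `eᵢ` on conjugates) needs this identity OVER
THE NUMBER FIELD `K` of the (normalised, hence `K`-rational) representatives `αᵢ`, and its
behaviour under `Gal(K/ℚ)`. This file provides, on top of the parallel seat's `evalForm`:

* `evalFormK D a` — the point form `ℓ_a` over any commutative semiring (`= evalForm` over `ℂ`,
  `evalFormK_eq_evalForm`; base change `map_evalFormK`), with `evalFormK_ne_zero`,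
  `prime_evalFormK`, `not_associated_evalFormK` over any field (the proofs of
  `RoySmallValueFactorization`, verbatim with `ℂ` replaced by a field);
* **`exists_descend_factorisation`** — if `F₀ ∈ K[r]` and `ι₀ F₀ = c ∏ ℓ_{ι₀ αᵢ}^{eᵢ}` in `ℂ[r]`
  for an embedding `ι₀ : K → ℂ` and points `αᵢ ∈ K³ ∖ 0`, then `c = ι₀ c'` and
  `F₀ = c' ∏ ℓ_{αᵢ}^{eᵢ}` in `K[r]` (`RoySmallValueExponents.exists_C_mul_of_map_eq`);
* **`exponent_perm_eq`** — if moreover a ring automorphism `g` of `K` fixes `F₀` (e.g. `F₀` has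
  rational coefficients) and permutes the pairwise non-proportional points, `g αᵢ = α_{π i}`, then
  `e_{π i} = eᵢ` (`RoySmallValueExponents.exponent_comp_eq`): the multiplicity is constant on
  Galois orbits, i.e. `Z = ∑ e_Z' Z'` over `ℚ`-irreducible components.

Everything is proved; the one definition has a body; no named facts.

## References

* [Roy2013] D. Roy, *A small value estimate for 𝔾ₐ × 𝔾ₘ*, Mathematika 59 (2013), 333–363
  (arXiv:1301.0663), §2 (Chow forms have integer coefficients; cycles `Z = ∑ eᵢ Zᵢ`; conjugate
  points) and §6, proof of Proposition 6.4.
-/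

noncomputable section

open MvPolynomial Finset

namespace Literature.NumberTheory.Transcendental

namespace Roy2013

variable {D : ℕ}

/-! ### The point forms over an arbitrary base -/

section Semiring

variable {R S : Type*} [CommSemiring R] [CommSemiring S]

/-- The point form `ℓ_a = ∑_ν a^ν r_ν` over any commutative semiring.
[cite: Roy2013, §6, proof of Proposition 6.4 (`R ↦ R(αᵢ)`)] -/
def evalFormK (D : ℕ) (a : Fin 3 → R) : MvPolynomial (CoefIdx D) R :=
  ∑ ν : CoefIdx D, C (∏ k, a k ^ (ν.1 k)) * X ν

/-- Over `ℂ` this is `evalForm`. [folklore] -/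
theorem evalFormK_eq_evalForm (α : Fin 3 → ℂ) : evalFormK D α = evalForm D α := rfl

/-- Base change of `ℓ_a`. [folklore] -/
theorem map_evalFormK (f : R →+* S) (a : Fin 3 → R) :
    map f (evalFormK D a) = evalFormK D (f ∘ a) := by
  simp only [evalFormK, map_sum, map_mul, map_C, map_X, map_prod, map_pow, Function.comp_apply]

/-- `ℓ_a` is a form of degree `1`. [folklore] -/
theorem isHomogeneous_evalFormK (a : Fin 3 → R) : (evalFormK D a).IsHomogeneous 1 := by
  refine IsHomogeneous.sum _ _ _ fun ν _ => ?_
  exact isHomogeneous_C_mul_X _ ν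

/-- The coefficient of `r_ν` in `ℓ_a` is `a^ν`. [folklore] -/
theorem coeff_evalFormK_single (a : Fin 3 → R) (ν : CoefIdx D) :
    coeff (Finsupp.single ν 1) (evalFormK D a) = ∏ k, a k ^ (ν.1 k) := by
  classical
  rw [evalFormK, coeff_sum, Finset.sum_eq_single ν]
  · rw [coeff_C_mul, coeff_X, if_pos rfl, mul_one]
  · intro μ _ hμ
    rw [coeff_C_mul, coeff_X, if_neg (fun h => hμ (Finsupp.single_left_injective one_ne_zero h)),
      mul_zero]
  · exact fun h => absurd (Finset.mem_univ ν) h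

/-- `a^{n e_k} = a_k^n`. [folklore] -/
theorem prod_pow_single (γ : Fin 3 → R) (k : Fin 3) (n : ℕ) :
    (∏ j, γ j ^ ((Finsupp.single k n : Fin 3 →₀ ℕ) j)) = γ k ^ n := by
  rw [← Finset.prod_subset (Finset.subset_univ {k}) (fun j _ hj => by
    rw [Finsupp.single_apply, if_neg (fun h' => hj (by rw [h']; exact mem_singleton_self _)),
      pow_zero]), Finset.prod_singleton, Finsupp.single_eq_same]

end Semiring

/-! ### Over a field: non-vanishing, primality, non-association -/

section Field

variable {K : Type*} [Field K]

/-- `ℓ_a ≠ 0` for `a ≠ 0`. [folklore] -/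
theorem evalFormK_ne_zero {a : Fin 3 → K} (ha : a ≠ 0) : evalFormK D a ≠ 0 := by
  obtain ⟨k, hk⟩ : ∃ k, a k ≠ 0 := by
    by_contra h0
    exact ha (funext fun k => by simpa using not_exists.mp h0 k)
  intro h
  have h1 := coeff_evalFormK_single a (⟨Finsupp.single k D, single_mem_finsuppAntidiag k⟩ : CoefIdx D)
  rw [h, coeff_zero, prod_pow_single] at h1
  exact pow_ne_zero D hk h1.symm

/-- A nonzero linear form over a field is irreducible. [folklore] -/
theorem irreducible_of_isHomogeneous_one' {τ : Type*} {ℓ : MvPolynomial τ K}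
    (hℓ : ℓ.IsHomogeneous 1) (h0 : ℓ ≠ 0) : Irreducible ℓ := by
  have hdeg : ℓ.totalDegree = 1 := hℓ.totalDegree h0
  refine ⟨fun hu => ?_, fun a b hab => ?_⟩
  · rw [isUnit_iff_totalDegree_of_isReduced] at hu
    omega
  · have ha0 : a ≠ 0 := fun h => h0 (by rw [hab, h, zero_mul])
    have hb0 : b ≠ 0 := fun h => h0 (by rw [hab, h, mul_zero])
    have hsum : a.totalDegree + b.totalDegree = 1 := by
      rw [← totalDegree_mul_of_isDomain ha0 hb0, ← hab, hdeg]
    rcases Nat.eq_zero_or_pos a.totalDegree with ha | ha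
    · left
      rw [isUnit_iff_totalDegree_of_isReduced]
      refine ⟨isUnit_iff_ne_zero.mpr fun hc => ha0 ?_, ha⟩
      rw [totalDegree_eq_zero_iff_eq_C.mp ha, hc, C_0]
    · right
      have hb : b.totalDegree = 0 := by omega
      rw [isUnit_iff_totalDegree_of_isReduced]
      refine ⟨isUnit_iff_ne_zero.mpr fun hc => hb0 ?_, hb⟩
      rw [totalDegree_eq_zero_iff_eq_C.mp hb, hc, C_0]

/-- **`ℓ_a` is prime** in `K[r]` for `a ≠ 0`. [folklore] -/
theorem prime_evalFormK {a : Fin 3 → K} (ha : a ≠ 0) : Prime (evalFormK D a) :=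
  (irreducible_of_isHomogeneous_one' (isHomogeneous_evalFormK a) (evalFormK_ne_zero ha)).prime

/-- Linear forms of non-proportional points do not divide each other (any field; the proof of
`RoySmallValueFactorization.not_evalForm_dvd_evalForm` verbatim). [folklore] -/
theorem not_evalFormK_dvd_evalFormK (hD : 1 ≤ D) {α β : Fin 3 → K} (hα : α ≠ 0) (hβ : β ≠ 0)
    (h : ¬∃ t : K, β = t • α) : ¬evalFormK D α ∣ evalFormK D β := by
  rintro ⟨u, hu⟩
  have hu0 : u ≠ 0 := fun h0 => evalFormK_ne_zero hβ (by rw [hu, h0, mul_zero])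
  have hdeg : u.totalDegree = 0 := by
    have h1 := (isHomogeneous_evalFormK (D := D) β).totalDegree (evalFormK_ne_zero hβ)
    rw [hu, totalDegree_mul_of_isDomain (evalFormK_ne_zero hα) hu0,
      (isHomogeneous_evalFormK (D := D) α).totalDegree (evalFormK_ne_zero hα)] at h1
    omega
  obtain hC := totalDegree_eq_zero_iff_eq_C.mp hdeg
  set c := coeff 0 u with hc
  have hcoef : ∀ ν : CoefIdx D, (∏ k, β k ^ (ν.1 k)) = c * ∏ k, α k ^ (ν.1 k) := by
    intro ν
    rw [← coeff_evalFormK_single β ν, hu, hC, mul_comm, coeff_C_mul, coeff_evalFormK_single]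
  obtain ⟨k₀, hk₀⟩ : ∃ k, β k ≠ 0 := by
    by_contra h0
    exact hβ (funext fun k => by simpa using not_exists.mp h0 k)
  have h1 := hcoef ⟨Finsupp.single k₀ D, single_mem_finsuppAntidiag k₀⟩
  simp only [prod_pow_single] at h1
  have hαk₀ : α k₀ ≠ 0 := by
    intro h0
    rw [h0, zero_pow (by omega), mul_zero] at h1
    exact pow_ne_zero D hk₀ h1
  have hmix : ∀ k, β k₀ ^ (D - 1) * β k = c * (α k₀ ^ (D - 1) * α k) := by
    intro k
    have hmem : Finsupp.single k₀ (D - 1) + Finsupp.single k 1 ∈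
        finsuppAntidiag (univ : Finset (Fin 3)) D := by
      rw [mem_finsuppAntidiag]
      refine ⟨?_, Finset.subset_univ _⟩
      rw [← Finsupp.degree_eq_sum, map_add, Finsupp.degree_single, Finsupp.degree_single]
      omega
    have h2 := hcoef ⟨_, hmem⟩
    simp only [Finsupp.coe_add, Pi.add_apply, pow_add, Finset.prod_mul_distrib, prod_pow_single,
      pow_one] at h2
    exact h2
  refine h ⟨β k₀ / α k₀, funext fun k => ?_⟩
  rw [Pi.smul_apply, smul_eq_mul]
  have h3 := hmix k
  have hβpow : β k₀ ^ (D - 1) ≠ 0 := pow_ne_zero _ hk₀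
  have eD : α k₀ ^ D = α k₀ ^ (D - 1) * α k₀ := by rw [← pow_succ, Nat.sub_add_cancel hD]
  have eD' : β k₀ ^ D = β k₀ ^ (D - 1) * β k₀ := by rw [← pow_succ, Nat.sub_add_cancel hD]
  have key : β k₀ ^ (D - 1) * (β k * α k₀) = β k₀ ^ (D - 1) * (β k₀ * α k) := by
    calc β k₀ ^ (D - 1) * (β k * α k₀) = (β k₀ ^ (D - 1) * β k) * α k₀ := by ring
      _ = c * (α k₀ ^ (D - 1) * α k) * α k₀ := by rw [h3]
      _ = (c * α k₀ ^ D) * α k := by rw [eD]; ring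
      _ = β k₀ ^ D * α k := by rw [← h1]
      _ = β k₀ ^ (D - 1) * (β k₀ * α k) := by rw [eD']; ring
  have key2 := mul_left_cancel₀ hβpow key
  field_simp
  linear_combination key2

/-- **Point forms of pairwise non-proportional points are pairwise non-associated primes.**
[folklore] -/
theorem not_associated_evalFormK (hD : 1 ≤ D) {α β : Fin 3 → K} (hα : α ≠ 0) (hβ : β ≠ 0)
    (h : ¬∃ t : K, β = t • α) : ¬Associated (evalFormK D α) (evalFormK D β) :=
  fun hass => not_evalFormK_dvd_evalFormK hD hα hβ h hass.dvd

/-! ### Descent of the factorisation from `ℂ` to `K` -/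

/-- **The factorisation of `F₀ ∈ K[r]` into point forms descends from `ℂ` to `K`.** If
`ι₀ F₀ = c ∏ᵢ ℓ_{ι₀ αᵢ}^{eᵢ}` in `ℂ[r]` for an embedding `ι₀ : K → ℂ` and points `αᵢ ∈ K³ ∖ 0`,
then `c = ι₀ c'` for some `c' ∈ K` and `F₀ = c' ∏ᵢ ℓ_{αᵢ}^{eᵢ}` in `K[r]`.
[cite: Roy2013, §2 (Chow forms have coefficients in `ℤ`), §6 proof of Prop. 6.4] -/
theorem exists_descend_factorisation (ι₀ : K →+* ℂ) {m : ℕ} {α : Fin m → Fin 3 → K}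
    (hα0 : ∀ i, α i ≠ 0) {F₀ : MvPolynomial (CoefIdx D) K} {c : ℂ} {e : Fin m → ℕ}
    (h : map ι₀ F₀ = C c * ∏ i, evalForm D (ι₀ ∘ α i) ^ e i) :
    ∃ c' : K, ι₀ c' = c ∧ F₀ = C c' * ∏ i, evalFormK D (α i) ^ e i := by
  letI : Algebra K ℂ := ι₀.toAlgebra
  have hG : (∏ i, evalFormK D (α i) ^ e i : MvPolynomial (CoefIdx D) K) ≠ 0 :=
    prod_ne_zero_iff.mpr fun i _ => pow_ne_zero _ (evalFormK_ne_zero (hα0 i))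
  have hmapG : map (algebraMap K ℂ) (∏ i, evalFormK D (α i) ^ e i) =
      ∏ i, evalForm D (ι₀ ∘ α i) ^ e i := by
    rw [map_prod]
    refine Finset.prod_congr rfl fun i _ => ?_
    rw [map_pow, map_evalFormK]; rfl
  have h' : map (algebraMap K ℂ) F₀ = C c * map (algebraMap K ℂ) (∏ i, evalFormK D (α i) ^ e i) := by
    rw [hmapG]; exact h
  exact exists_C_mul_of_map_eq hG h'

/-- The leading constant over `K` is non-zero if `c` is. [folklore] -/
theorem descend_ne_zero (ι₀ : K →+* ℂ) {c' : K} {c : ℂ} (h : ι₀ c' = c) (hc : c ≠ 0) : c' ≠ 0 := by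
  rintro rfl; exact hc (by rw [← h, map_zero])

/-! ### The exponents are constant on Galois orbits -/

/-- **`e_{π i} = eᵢ` when an automorphism of `K` fixing `F₀` permutes the points via `π`.**
For `F₀ = c' ∏ᵢ ℓ_{αᵢ}^{eᵢ}` in `K[r]` with pairwise non-proportional `αᵢ ≠ 0`, `c' ≠ 0`,
`D ≥ 1`, a ring automorphism `g` of `K` with `g F₀ = F₀` (coefficientwise) and
`g ∘ αᵢ = α_{π i}`: `e (π i) = e i`. [cite: Roy2013, §2 ("`Z = e_1 Z_1 + ⋯ + e_s Z_s`", the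
points of `Z(ℂ)` are conjugate over `ℚ`)] -/
theorem exponent_perm_eq (hD : 1 ≤ D) {m : ℕ} {α : Fin m → Fin 3 → K} (hα0 : ∀ i, α i ≠ 0)
    (hsep : ∀ i j, i ≠ j → ¬∃ t : K, α j = t • α i) {F₀ : MvPolynomial (CoefIdx D) K} {c' : K}
    (hc' : c' ≠ 0) {e : Fin m → ℕ} (hF₀ : F₀ = C c' * ∏ i, evalFormK D (α i) ^ e i)
    (g : K ≃+* K) (hg : map (g : K →+* K) F₀ = F₀) (π : Fin m → Fin m)
    (hπ : ∀ i, (g : K →+* K) ∘ α i = α (π i)) : ∀ i, e (π i) = e i := by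
  have hprime : ∀ j ∈ (univ : Finset (Fin m)), Prime (evalFormK D (α j)) :=
    fun j _ => prime_evalFormK (hα0 j)
  have hnass : ∀ i ∈ (univ : Finset (Fin m)), ∀ j ∈ (univ : Finset (Fin m)), i ≠ j →
      ¬Associated (evalFormK D (α i)) (evalFormK D (α j)) :=
    fun i _ j _ hij => not_associated_evalFormK hD (hα0 i) (hα0 j) (hsep i j hij)
  have hu : IsUnit (C c' : MvPolynomial (CoefIdx D) K) := (isUnit_iff_ne_zero.mpr hc').map C
  intro i
  refine exponent_comp_eq univ (fun j => evalFormK D (α j)) e hu hprime hnass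
    (mapEquiv (CoefIdx D) g) hF₀ ?_ π (fun j _ => mem_univ _) (fun j _ => ?_) i (mem_univ _)
  · rw [mapEquiv_apply]; exact hg
  · rw [mapEquiv_apply, map_evalFormK, hπ j]

/-- The typical fixed polynomial: an integer polynomial is fixed by every automorphism.
[folklore] -/
theorem map_ringEquiv_map_intCast (g : K ≃+* K) {τ : Type*} (F : MvPolynomial τ ℤ) :
    map (g : K →+* K) (map (Int.castRingHom K) F) = map (Int.castRingHom K) F := by
  rw [MvPolynomial.map_map]
  exact congrArg (fun φ : ℤ →+* K => MvPolynomial.map φ F) (RingHom.ext_int _ _)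

end Field

end Roy2013

end Literature.NumberTheory.Transcendental
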